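import Literature.Computability.Complexity.SymmetricThresholdProgramsVecCmp
import Literature.Computability.Complexity.SymmetricThresholdProgramsRefineIter
import Summits.PneNP.PneNP.Theorems.SymmetryBudgetNoHiddenOrderReplayAtomDefs
import Summits.PneNP.PneNP.Theorems.SymmetryBudgetNoHiddenOrderPerPathRefine

/-!
# `NoHiddenOrder` (stmt-PneNP-14781), (R2c) replay circuit III: the ROOT STATE module — definitions

Route `PneNP/SymmetryBudget`.  From the input MATRIX `x : Fin m × Fin m → Bool` to the root state of the replay of a
pointer `v` of the window `W ⊆ Fin m`: `ReplayRoot P m N T J` holds, as kit gadgets with consistency equations,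

* two constant gates and the symmetrised adjacency gates `adjG u v = [u ≠ v] ∧ (x(u,v) ∨ x(v,u))` (the graph
  `rootGraph x = SimpleGraph.fromRel (x · · = true)` of the route);
* a `VecCmp` gadget comparing the SIGNATURES of window vertices towards the ordered part (row bits `x(u,i)` and column
  bits `x(i,u)`, `i ∉ W`; window positions read a constant): its `less/eqall` wires are the order/kernel of the INITIAL
  COLOURING `rootCol` (competition rank of the signature inside `W`);
* a `RefineIter` module on the whole window from that colouring (its last wires read `refineIn G W rootCol`), and
* for every pointer `v` an `AtomIter` module under the refined kernel (its output reads `atom G W (refineIn …) v`).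
The root state wires of `v` — `(AI v).memW (Fin.last J)`, `RI.ltW (Fin.last T)`, `RI.eqW (Fin.last T)` — are what a
`ReplayIter` reads at stage `0` (`…ReplayIterDefs.lean`).  Semantics in `SymmetryBudgetNoHiddenOrderReplayRoot.lean`.
Definitions only; supports stmt-PneNP-14781.
-/

set_option linter.dupNamespace false -- `Summit.PneNP.PneNP.…` (D-0017 single-conjunct layout)

namespace Summit.PneNP.PneNP.Theorems

open Finset Literature.Computability.Complexity Literature.Computability.Complexity.SymProg

/-- The graph of an input matrix (the route's `Gr`): symmetrised, loops dropped. [folklore] -/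
abbrev rootGraph {m : ℕ} (x : Fin m × Fin m → Bool) : SimpleGraph (Fin m) :=
  SimpleGraph.fromRel fun u v => x (u, v) = true

/-- The SIGNATURE WIRE `j` of the vertex `u` towards the ordered part `Wᶜ`: for `j < m` the row entry `(u, j)`, for
`m ≤ j < 2m` the column entry `(j - m, u)`; positions inside the window read the constant `ffW`. [folklore] -/
def sigWire {Λ : Type*} {m : ℕ} (W : Finset (Fin m)) (ffW : (Fin m × Fin m) ⊕ Λ) (u : Fin m) (j : Fin (m + m)) :
    (Fin m × Fin m) ⊕ Λ :=
  if h : (j : ℕ) < m then (if (⟨j, h⟩ : Fin m) ∈ W then ffW else Sum.inl (u, ⟨j, h⟩))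
  else (if (⟨j - m, by omega⟩ : Fin m) ∈ W then ffW else Sum.inl (⟨j - m, by omega⟩, u))

variable {Λ : Type*} [DecidableEq Λ] {m : ℕ} (P : SymProg (Fin m × Fin m) Λ) (N T J : ℕ)

/-- **The root-state module** (see the module docstring). [folklore] -/
structure ReplayRoot where
  /-- the window -/
  W : Finset (Fin m)
  /-- the constant `true` -/
  tt : Λ
  /-- the constant `false` -/
  ff : Λ
  /-- symmetrised adjacency gates -/
  adjG : Fin m → Fin m → Λ
  /-- signature comparison of window vertices -/
  VC : P.VecCmp (Fin m) (m + m)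
  /-- root refinement on the window -/
  RI : P.RefineIter (Fin m) N T
  /-- root atom module of every pointer -/
  AI : Fin m → AtomIter P (Fin m) N T J
  kind_tt : P.kind tt = Kind.and
  srcs_tt : P.srcs tt = ∅
  kind_ff : P.kind ff = Kind.or
  srcs_ff : P.srcs ff = ∅
  kind_adjG : ∀ u v, P.kind (adjG u v) = Kind.or
  srcs_adjG : ∀ u v, P.srcs (adjG u v) = if u = v then ∅ else {Sum.inl (u, v), Sum.inl (v, u)}
  VC_b : ∀ u j, VC.b u j = sigWire W (Sum.inr ff) u j
  RI_mem : ∀ u, RI.mem u = if u ∈ W then Sum.inr tt else Sum.inr ff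
  RI_adj : ∀ u v, RI.adj u v = Sum.inr (adjG u v)
  RI_lt0 : ∀ u v, RI.lt0 u v = Sum.inr (VC.less u v)
  RI_eq0 : ∀ u v, RI.eq0 u v = Sum.inr (VC.eqall u v)
  AI_mem0 : ∀ v u, (AI v).mem0 u = RI.mem u
  AI_adj : ∀ v a b, (AI v).adj a b = Sum.inr (adjG a b)
  AI_eq : ∀ v a b, (AI v).eq a b = RI.eqW (Fin.last T) a b
  AI_ptr : ∀ v, (AI v).ptr = v

namespace ReplayRoot

variable {P N T J} (RR : ReplayRoot P N T J) (x : Fin m × Fin m → Bool)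

/-- The INITIAL COLOURING of the window: the competition rank of the signature inside `W`. [folklore] -/
noncomputable def rootCol : Fin m → ℕ := fun u => RR.VC.rankIn x RR.W u

/-- The ROOT COLOURING: `|W|` rounds of ordered refinement of the initial colouring inside the window. [folklore] -/
noncomputable def rootRef : Fin m → ℕ := BranchSum.refineIn (rootGraph x) RR.W (RR.rootCol x)

/-- The ROOT BLOCK of the pointer `v`: its atom in the window under the root colouring. [folklore] -/
noncomputable def rootBlock (v : Fin m) : Finset (Fin m) := BranchSum.atom (rootGraph x) RR.W (RR.rootRef x) v

end ReplayRoot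

end Summit.PneNP.PneNP.Theorems
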